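import Summits.BirchSwinnertonDyer.Rank1Residual.X1.GeneratorCountLayerCertificatesTorsion
import Summits.BirchSwinnertonDyer.Rank1Residual.X2.GreenbergVatsalTransferMultiplicative
import Literature.NumberTheory.EllipticCurves.TateCurve.NumberFieldUniformizationTwisted
import Summits.BirchSwinnertonDyer.BirchSwinnertonDyer.Theorems.EisensteinPrimesAlgebraicLambdaGEBudget
import HarnessLib

/-!
# The TOWER budget WITH rational `p`-torsion at a MULTIPLICATIVE Eisenstein prime:
# `Σ_{v ∈ S} p^{min(n, m_v)} ≤ λ + pⁿ μ + 2k` over the layers `ℚ_n`, and the λ-conjunct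
# `AlgebraicLambdaGE W₀ p (Σ_v s_v − 2k)` of `stub_lambdaCount_offLocus` at the étale end
# (route `EisensteinPrimes`, crux 3 `MazurMCOnCellB` = stmt-BirchSwinnertonDyer-19033, line `mudescent`,
# stub `stub_lambdaCount_offLocus`, ALGEBRAIC half; LEAD seat bsd-line-x2-p1, D-0154 row 5)

HONEST FRAMING (cell `bsd-eis`; nothing here proves BSD or a main conjecture; 0 cells move): THEOREMS
ONLY — no definition, no named fact, nothing asserted about any particular curve, closes nothing. The
stub `stub_lambdaCount_offLocus` (Greenberg–Vatsal's λ-count at type A) stays OPEN class-wide; this file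
supplies the ALGEBRAIC lower bound over the LAYERS of the cyclotomic tower at a member CARRYING rational
`p`-power torsion (`δ ≥ 1`) — the case of the étale end `W₀` of a type-A multiplicative class with
trivial even character, where every earlier kernel budget was either layer `0`
(`X2.algebraicLambdaGE_of_dvd_torsionOrder_of_dvd_localTamagawaNumber`, p480562: `λ ≥ #S′ + 1 − 2δ`, one
unit per Tamagawa PLACE of `ℚ`) or torsion-free (`X2.algebraicLambdaGE_layer_of_certificates`, p469158,
Greenberg Prop. 4.14 needs `p ∤ #E(ℚ)_tors`). Consequence for the line: on the Mazur twin family the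
side condition «`Σ_{ℓ∈S} s_ℓ ≤ #S′`» (all `s_ℓ = 1`) of lam-a's route-T closure
`X2.mazurMainConjectureAt_etaleEnd_of_valueCongr_unit_of_dvd_localTamagawaNumber` (p547788) is what
this tower count removes, at the price of the parity squeeze (`n ≤ k + e + 1`): see §3.

WHAT IS PROVED.
* §1 `pow_sum_pow_min_le_pow_mul_sq_of_certificates` — for `E = W/ℚ` globally minimal, `p` odd of
  MULTIPLICATIVE reduction, `κ` cyclotomic, ANY Pontryagin-dual datum `D` of `Sel_{p^∞}(E/ℚ_∞)` with
  `X` finitely generated, torsion and without non-zero finite submodules, a finite set `S` of places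
  `v ∤ p` with the census columns `v_p(N(v)^{p−1} − 1) = m_v + 1` and `p ∣ c_v(E)`:
  `p^{Σ_{v∈S} p^{min(n,m_v)}} ≤ p^{λ(X) + pⁿ μ(X)} · #(E[p^∞]^{Gal(ℚ̄/ℚ_n)})²` — eisenstein-p1's
  layer-`n` engine (`X1.GeneratorCountLayerLocal.natCard_le_natCard_quotient_layerIdeal_mul_sq_of_local`,
  the relaxed Kummer structure of `X1.RelaxedKummerCountPow` with index `p⁰` at the place above `p`,
  n1011's place counts and layer Tamagawa witnesses) run with NO local package at `p`: at a
  multiplicative prime the `ℚ_∞`-condition at `p` of a class that is Kummer at the place of `ℚ_n`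
  above `p` is the Kummer functoriality `Sel(E/ℚ_n) → Sel(E/ℚ_∞)` (n1011's transport
  `X1.LayerClassesToSelmerInfty.conjH1_kerH1Iso_mem_localKerOver_adicCompletion_of_liesOver`), so NO
  ordinarity / Prop. 2.4 input is needed; the finiteness of `E(ℚ_∞)[p^∞]` at `p ‖ N` is the tree's
  (`X2.GreenbergVatsalTransferMultiplicative.finite_fixedPoints_kerSubgroup_of_hasMultiplicativeReductionAtPrime`,
  twisted Tate uniformisation DISCHARGED).
* §2 `sum_pow_min_le_lambda_add_of_certificates` — the same as `Σ_v p^{min(n,m_v)} ≤ λ + pⁿμ + 2k`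
  given the layer-`n` torsion certificate `#E[p^∞]^{Gal(ℚ̄/ℚ_n)} ≤ p^k`.
* §3 `X2.algebraicLambdaGE_layer_of_dvd_localTamagawaNumber_of_layerTorsion` — in the stub's
  currency: `X2.AnalyticMuLE W p m'` (the cell's certificate; `μ(X) ≤ m'` by Wuthrich Thm. 16) ⇒
  `AlgebraicLambdaGE W p (Σ_v p^{min(n,m_v)} − pⁿ m' − 2k)`; at a `μ_an = 0` member (the étale end,
  `stub_analyticMuZero_offLocus`) this is `λ_alg ≥ t_n − 2k`, `t_n = Σ_{v∈S} min(s_v, pⁿ)`.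

Named PUBLISHED facts enter as hypotheses exactly as in the composed files: Poitou–Tate duality and
the local Euler–Poincaré formula over `ℚ_n` (`hPT`, `hEP`), Greenberg 1999 Prop. 4.15 (ii) (`h415`),
Wuthrich 2014 Thm. 16 (`hWu`), modularity (`hpar`). The `a`-term at the split prime (`+1` while
`n < ord_p log_p q_E − 1`, Greenberg pp. 91–93) is NOT included (it dies in the tower); the parity form
of route T (`X2.mazurMainConjectureAt_of_algebraicLambdaGE_of_parity`) is the intended consumer.

References: [GreenbergLNM1716] §3 Lemma 3.1, pp. 85–93, §5 pp. 114–118 (proof of Cor. 5.6), p. 137,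
Prop. 4.15 (ii); [Washington1997] §13.1 (Prop. 13.2); [Wuthrich2014] Thm. 16 (p. 397);
[GreenbergVatsal2000] §2 p. 28; HOME/ky-g8/Lines-mudescent.v3.md; HOME/lam-a-g12 (MEMO-12, «your layer
budget»).
-/

set_option autoImplicit false
-- `Summit.BirchSwinnertonDyer.BirchSwinnertonDyer.…`: the summit and its single sub-problem share a name (D-0017 layout).
set_option linter.dupNamespace false

noncomputable section

open scoped Classical

open Function Field NumberField IsDedekindDomain WeierstrassCurve PowerSeries
  Literature.NumberTheory.EllipticCurves Literature.NumberTheory.GaloisRepresentations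
  Literature.NumberTheory.GaloisCohomology Summit.BirchSwinnertonDyer.Rank1Residual.GaloisImage
  Literature.NumberTheory.EllipticCurves.IwasawaAlgebra
  Summit.BirchSwinnertonDyer.Rank1Residual.Additive
  Summit.BirchSwinnertonDyer.Rank1Residual.Additive.ZpTower
  Summit.BirchSwinnertonDyer.Rank1Residual.X1
  Summit.BirchSwinnertonDyer.Rank1Residual.X1.GeneratorBoundMuLayer
open Literature.NumberTheory.GaloisRepresentations.DiscreteGaloisModule (SelmerStructure unramifiedSubgroup)

namespace Summit.BirchSwinnertonDyer.BirchSwinnertonDyer.Theorems.EisensteinPrimesX2TowerBudgetTorsion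

variable {W : WeierstrassCurve ℚ} [W.IsElliptic] [W.IsGloballyMinimal] {p : ℕ} [hp : Fact p.Prime]

/-! ## §1. `p^{Σ_{v∈S} p^{min(n,m_v)}} ≤ p^{λ + pⁿμ} · #(E[p^∞]^{Gal(ℚ̄/ℚ_n)})²` at a multiplicative `p` -/

/-- **The layer-`n` Tamagawa count WITH torsion loss and NO local package at `p`, multiplicative `p`.**
`E = W/ℚ` globally minimal, `p` odd of multiplicative reduction, `κ` cyclotomic with any `γ`, `D` a
Pontryagin-dual datum of `Sel_{p^∞}(E/ℚ_∞)` with `X = D.X` finitely generated, torsion, without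
non-zero finite submodules; `S` a finite set of places `v ∤ p` with `v_p(N(v)^{p−1} − 1) = m_v + 1`
and `p ∣ c_v(E)`. Modulo Poitou–Tate duality over `ℚ_n` (`hPT`) and the local Euler–Poincaré formula
at the places of `ℚ_n` (`hEP`), named PUBLISHED facts:
**`p^{Σ_{v ∈ S} p^{min(n, m_v)}} ≤ p^{λ(X) + pⁿ μ(X)} · #{b ∈ E[p^∞] | Gal(ℚ̄/ℚ_n)·b = b}²`** —
`#{w ∣ v} = p^{min(n,m_v)}` Tamagawa witnesses above each `v ∈ S` (Kodaira–Néron, n1011), the relaxed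
Kummer structure counted by Poitou–Tate pair counting, transported into `Sel_{p^∞}(E/ℚ_∞)` with fibres
in `E_{ℚ_n}[p^∞]^{Γ_{ℚ_n}}` (Greenberg's Lemma 3.1); at the place above `p` the classes are Kummer and
stay Kummer over `ℚ_∞`. [cite: GreenbergLNM1716, §3 Lemma 3.1 and pp. 85–86, §5 pp. 114–118, p. 137]
[cite: Washington1997, §13.1 (Prop. 13.2)] [cite: SilvermanATAEC1994, Cor. IV.9.2(d), IV.9.4 Step 2] -/
theorem pow_sum_pow_min_le_pow_mul_sq_of_certificates (hodd : p ≠ 2) (n : ℕ)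
    (hPT : ∀ (κ : ZpExtension ℚ p) [NumberField (κ.layer n)], κ.IsCyclotomic →
      poitouTate_selmerStructure_duality (κ.layer n))
    (hEP : ∀ (κ : ZpExtension ℚ p) [NumberField (κ.layer n)], κ.IsCyclotomic →
      ∀ w : HeightOneSpectrum (𝓞 (κ.layer n)),
      localEulerPoincareCharacteristic (w.adicCompletion (κ.layer n)))
    (hmult : W.HasMultiplicativeReductionAtPrime p)
    (vp : HeightOneSpectrum (𝓞 ℚ)) (hvp : ((p : ℕ) : 𝓞 ℚ) ∈ vp.asIdeal)
    (S : Finset (HeightOneSpectrum (𝓞 ℚ))) (m : HeightOneSpectrum (𝓞 ℚ) → ℕ)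
    (hSp : ∀ v ∈ S, ((p : ℕ) : 𝓞 ℚ) ∉ v.asIdeal)
    (hval : ∀ v ∈ S, padicValNat p (v.residueCard ^ (p - 1) - 1) = m v + 1)
    (hcv : ∀ v ∈ S,
      p ∣ (W.baseChange (v.adicCompletion ℚ)).localTamagawaNumber (v.adicCompletionIntegers ℚ))
    {κ : ZpExtension ℚ p} {γ : Field.absoluteGaloisGroup ℚ} (hκ : κ.IsCyclotomic)
    (D : W.SelmerDualData κ γ) [Module.Finite (IwasawaAlgebra p) D.X] (hX : D.IsTorsion)
    (hnf : ∀ N : Submodule (IwasawaAlgebra p) D.X, Finite N → N = ⊥) :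
    p ^ (∑ v ∈ S, p ^ min n (m v)) ≤
      p ^ (lambdaInvariant p D.X + p ^ n * muInvariant p D.X) *
        Nat.card {b : geomPrimaryTorsion W p //
          ∀ σ : Field.absoluteGaloisGroup ℚ, σ ∈ κ.layerSubgroup n → σ • b = b} ^ 2 := by
  haveI : NeZero p := ⟨hp.out.ne_zero⟩
  -- the restricted tower over `ℚ_n` and the Poitou–Tate family
  obtain ⟨κn, hκn⟩ := ZpTower.exists_restrictTower κ n
  have hκnc : κn.IsCyclotomic := ZpTower.isCyclotomic_restrictTower κ n κn hκn hκ
  obtain ⟨inv, hperf, hsum, -, hcompl⟩ := hPT κ hκ p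
  -- finiteness of `E(ℚ_∞)[p^∞]` at `p ‖ N` (twisted Tate uniformisation, DISCHARGED in the tree)
  have hfix : Set.Finite {b : geomPrimaryTorsion W p |
      ∀ τ : Field.absoluteGaloisGroup ℚ, τ ∈ κ.kerSubgroup → τ • b = b} := by
    haveI := Summit.BirchSwinnertonDyer.Rank1Residual.X2.GreenbergVatsalTransferMultiplicative.finite_fixedPoints_kerSubgroup_of_hasMultiplicativeReductionAtPrime
      W p TateCurve.Silverman1994_thmV53_corV54_tateUniformisation_holds hodd hmult κ hκ
    refine (Set.finite_coe_iff.mp ‹Finite (FixedPoints.addSubgroup κ.kerSubgroup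
      (geomPrimaryTorsion W p))›).subset fun b hb ↦ ?_
    exact (FixedPoints.mem_addSubgroup _ _ _).mpr fun τ ↦ by rw [Subgroup.smul_def]; exact hb τ τ.2
  -- places of `ℚ_n` over `S` with their Tamagawa witnesses
  obtain ⟨T₀, hcard, hP⟩ := exists_finset_placesOver_card_ge S (fun v ↦ p ^ min n (m v))
    (fun v hv ↦ (pow_min_eq_natCard_placesOver_layer κ hκ hodd n (hSp v hv) (hval v hv)).le)
    (fun w ↦ ((p : ℕ) : 𝓞 (κ.layer n)) ∉ w.asIdeal ∧
      ∃ u ∈ unramifiedSubgroup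
          (((W.baseChange (κ.layer n)).torsionGaloisModule (p : ℤ)).restrictField
            (w.adicCompletion (κ.layer n))) 1,
        u ∉ (W.baseChange (κ.layer n)).kummerLocalConditionAt (p : ℤ)
          (w.adicCompletion (κ.layer n)))
    (fun v hv w hw ↦ ⟨natCast_not_mem_asIdeal_of_under_eq (hSp v hv) w hw,
      exists_mem_unramifiedSubgroup_not_mem_kummerLocalConditionAt_layer_of_odd_of_dvd_localTamagawaNumber
        hodd κ n (hSp v hv) (hcv v hv) w hw⟩)
  -- a place `wp` of `ℚ_n` above `p`; it is not in `T₀`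
  obtain ⟨wp, hwpv, -⟩ := GeneratorCountLayerAtPLocal.exists_factorisation κ n vp
  haveI : wp.asIdeal.LiesOver vp.asIdeal := hwpv
  have hpw : ∀ w : HeightOneSpectrum (𝓞 (κ.layer n)), w.asIdeal.LiesOver vp.asIdeal →
      ((p : ℕ) : 𝓞 (κ.layer n)) ∈ w.asIdeal := fun w hw ↦ by
    have h1 : (algebraMap (𝓞 ℚ) (𝓞 (κ.layer n))) ((p : ℕ) : 𝓞 ℚ) ∈ w.asIdeal := by
      rw [← Ideal.mem_comap]
      have h2 : vp.asIdeal = w.asIdeal.comap (algebraMap (𝓞 ℚ) (𝓞 (κ.layer n))) := hw.over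
      rw [← h2]; exact hvp
    rwa [map_natCast] at h1
  have hwT₀ : ∀ w : HeightOneSpectrum (𝓞 (κ.layer n)), w.asIdeal.LiesOver vp.asIdeal → w ∉ T₀ :=
    fun w hw h ↦ (hP w h).1 (hpw w hw)
  have hwpT₀ : wp ∉ T₀ := hwT₀ wp hwpv
  -- the relaxed Kummer structure: unramified classes on `T₀`, KUMMER at `wp` (index `p⁰`)
  obtain ⟨Sg, hSfin, hcardS, hS⟩ := RelaxedKummerCountPow.exists_addSubgroup_relaxedKummer_at_pow
    (W := W.baseChange (κ.layer n)) hodd inv hperf hsum hcompl (hEP κ hκ) T₀ (fun w hw ↦ (hP w hw).2)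
    wp hwpT₀ (fun w ↦ (W.baseChange (κ.layer n)).kummerSelmerStructure (p : ℤ) (Sum.inr w)) le_rfl 0
    (by rw [pow_zero, one_mul])
  haveI : Finite Sg := hSfin
  rw [add_zero] at hcardS
  -- every class of `Sg` is Kummer at EVERY place of `ℚ_n` above `p`
  have hKum : ∀ y ∈ Sg, ∀ w : HeightOneSpectrum (𝓞 (κ.layer n)), w.asIdeal.LiesOver vp.asIdeal →
      y ∈ selmerLocalKer (W.baseChange (κ.layer n)) (w.adicCompletion (κ.layer n)) (p : ℤ) := by
    intro y hy w hw
    by_cases hweq : w = wp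
    · subst hweq
      have h := (hS y hy).2.2.2
      have h' : y ∈ ((W.baseChange (κ.layer n)).kummerSelmerStructure (p : ℤ) (Sum.inr w)).comap
          (galoisCohomology.localization ((W.baseChange (κ.layer n)).torsionGaloisModule (p : ℤ))
            (Sum.inr w) 1) := h
      rw [comap_localization_kummerSelmerStructure] at h'
      exact h'
    · refine (hS y hy).1 w ?_
      rw [Finset.coe_insert, Set.mem_insert_iff, not_or]
      exact ⟨hweq, fun h ↦ hwT₀ w hw h⟩
  have hFix := LayerFixedPointsCount.finite_fixedPoints_kerSubgroup_restrictTower W κ n κn hκn hfix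
  -- the count (the two `Finite` instances are passed explicitly: the `ℚ`-algebra structure on `ℚ_n`
  -- elaborates here as `DivisionRing.toRatAlgebra`, in the `K`-general engine as the layer's
  -- `IntermediateField.algebra'` — defeq, but beyond instance transparency)
  have hcount := @GeneratorCountLayerLocal.natCard_le_natCard_quotient_layerIdeal_mul_sq_of_local
    ℚ _ _ p _ W κ n κn hκn γ D _ _ hFix Sg hSfin vp (↑T₀ : Set (HeightOneSpectrum (𝓞 (κ.layer n))))
    (fun y hy w hwT hwv ↦ (hS y hy).1 w (by
      rw [Finset.coe_insert, Set.mem_insert_iff, not_or]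
      exact ⟨fun h ↦ hwv (h ▸ hwpv), hwT⟩))
    (fun y hy w ↦ (hS y hy).2.1 w)
    (fun y hy w hw ↦ by
      have hw' : w ∈ T₀ := Finset.mem_coe.mp hw
      exact layerToInfty_resH1Hom_torsionToPrimaryH1_mem_localKerOver_of_mem_unramified_sup_kummer
        (W.baseChange (κ.layer n)) p κn w (hP w hw').1
        (exists_apply_resGal_ne_one_of_isCyclotomic κn hκnc w (hP w hw').1) y
        ((hS y hy).2.2.1 w hw'))
    (fun y hy σ ↦ LayerClassesToSelmerInfty.conjH1_kerH1Iso_mem_localKerOver_adicCompletion_of_liesOver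
      W κ n κn hκn vp σ _ (fun w hw σ' ↦ by
        rw [conjH1_layerToInfty_zero]
        exact layerToInfty_zero_mem_localKerOver_of_mem (W.baseChange (κ.layer n)) p κn
          (resH1Hom_mem_localKerOver_layerZero_of_mem_selmerLocalKerPrimary
            (W.baseChange (κ.layer n)) p κn
            ((torsionToPrimaryH1_mem_selmerLocalKerPrimary_iff (W.baseChange (κ.layer n)) p
              y).mpr (hKum y hy w hw)))))
  -- assemble
  rw [← LayerFixedPointsCount.natCard_fixedPoints_layer_eq W κ n]
  calc p ^ (∑ v ∈ S, p ^ min n (m v))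
      ≤ p ^ T₀.card := Nat.pow_le_pow_right hp.out.pos hcard
    _ ≤ Nat.card Sg := hcardS
    _ ≤ _ := hcount
    _ ≤ _ := Nat.mul_le_mul_right _ (natCard_quotient_layerIdeal_le_pow D.X hX hnf n)

/-! ## §2. `Σ_{v∈S} p^{min(n,m_v)} ≤ λ + pⁿμ + 2k` from the layer-`n` torsion certificate -/

/-- **`Σ_{v ∈ S} p^{min(n, m_v)} ≤ λ(X) + pⁿ μ(X) + 2k`** when `#{b ∈ E[p^∞] | Gal(ℚ̄/ℚ_n)·b = b} ≤ p^k`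
(a layer-`n` torsion certificate; `k = v_p(#E(ℚ_n)[p^∞])`), same hypotheses as §1 — route T's recipe
`t_n − 2δ_n ≤ λ + pⁿμ` at `p ‖ N` without the `a`-term.
[cite: GreenbergLNM1716, §3 Lemma 3.1, §5 pp. 114–118, p. 137] [cite: Washington1997, §13.1 (Prop. 13.2)] -/
theorem sum_pow_min_le_lambda_add_of_certificates (hodd : p ≠ 2) (n : ℕ)
    (hPT : ∀ (κ : ZpExtension ℚ p) [NumberField (κ.layer n)], κ.IsCyclotomic →
      poitouTate_selmerStructure_duality (κ.layer n))
    (hEP : ∀ (κ : ZpExtension ℚ p) [NumberField (κ.layer n)], κ.IsCyclotomic →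
      ∀ w : HeightOneSpectrum (𝓞 (κ.layer n)),
      localEulerPoincareCharacteristic (w.adicCompletion (κ.layer n)))
    (hmult : W.HasMultiplicativeReductionAtPrime p)
    (vp : HeightOneSpectrum (𝓞 ℚ)) (hvp : ((p : ℕ) : 𝓞 ℚ) ∈ vp.asIdeal)
    (S : Finset (HeightOneSpectrum (𝓞 ℚ))) (m : HeightOneSpectrum (𝓞 ℚ) → ℕ)
    (hSp : ∀ v ∈ S, ((p : ℕ) : 𝓞 ℚ) ∉ v.asIdeal)
    (hval : ∀ v ∈ S, padicValNat p (v.residueCard ^ (p - 1) - 1) = m v + 1)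
    (hcv : ∀ v ∈ S,
      p ∣ (W.baseChange (v.adicCompletion ℚ)).localTamagawaNumber (v.adicCompletionIntegers ℚ))
    {κ : ZpExtension ℚ p} {γ : Field.absoluteGaloisGroup ℚ} (hκ : κ.IsCyclotomic)
    (D : W.SelmerDualData κ γ) [Module.Finite (IwasawaAlgebra p) D.X] (hX : D.IsTorsion)
    (hnf : ∀ N : Submodule (IwasawaAlgebra p) D.X, Finite N → N = ⊥) {k : ℕ}
    (hB : Nat.card {b : geomPrimaryTorsion W p //
      ∀ σ : Field.absoluteGaloisGroup ℚ, σ ∈ κ.layerSubgroup n → σ • b = b} ≤ p ^ k) :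
    ∑ v ∈ S, p ^ min n (m v) ≤ lambdaInvariant p D.X + p ^ n * muInvariant p D.X + 2 * k := by
  have h := pow_sum_pow_min_le_pow_mul_sq_of_certificates hodd n hPT hEP hmult vp hvp S m hSp hval hcv
    hκ D hX hnf
  have h2 : p ^ (∑ v ∈ S, p ^ min n (m v)) ≤
      p ^ (lambdaInvariant p D.X + p ^ n * muInvariant p D.X + 2 * k) :=
    calc p ^ (∑ v ∈ S, p ^ min n (m v))
        ≤ p ^ (lambdaInvariant p D.X + p ^ n * muInvariant p D.X) *
          Nat.card {b : geomPrimaryTorsion W p //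
            ∀ σ : Field.absoluteGaloisGroup ℚ, σ ∈ κ.layerSubgroup n → σ • b = b} ^ 2 := h
      _ ≤ p ^ (lambdaInvariant p D.X + p ^ n * muInvariant p D.X) * (p ^ k) ^ 2 :=
          Nat.mul_le_mul_left _ (Nat.pow_le_pow_left hB 2)
      _ = p ^ (lambdaInvariant p D.X + p ^ n * muInvariant p D.X + 2 * k) := by
          rw [← pow_mul, ← pow_add, Nat.mul_comm k 2]
  exact (Nat.pow_le_pow_iff_right hp.out.one_lt).mp h2

/-! ## §3. In the currency of `stub_lambdaCount_offLocus`: `AlgebraicLambdaGE` at a `μ_an ≤ m'` member -/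

section Stub

open Summit.BirchSwinnertonDyer.Rank1Residual
  Summit.BirchSwinnertonDyer.Rank1Residual.X1.TamagawaSqueeze
  Summit.BirchSwinnertonDyer.Rank1Residual.X1.GeneratorSqueeze
  Summit.BirchSwinnertonDyer.BirchSwinnertonDyer.Theorems.EisensteinPrimesAlgebraicLambdaGEBudget
  Literature.NumberTheory.EllipticCurves.Wuthrich2014
  Literature.NumberTheory.EllipticCurves.Greenberg1999
  Literature.NumberTheory.EllipticCurves.ModularForms

/-- **`λ_alg ∈ {d | Σ_{v∈S} p^{min(n,m_v)} ≤ d + pⁿ m' + 2k}` at an X2 member with `μ_an ≤ m'` and a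
layer-`n` torsion certificate `#E[p^∞]^{Gal(ℚ̄/ℚ_n)} ≤ p^k` for every cyclotomic `κ`** — `p ‖ N` odd,
`E[p]` reducible; `μ(X) ≤ m'` by Wuthrich Thm. 16 + modularity (p469158's
`X2.isTorsion_and_mu_le_of_analyticMuLE`), no finite submodule by Greenberg Prop. 4.15 (ii) BY NAME,
Poitou–Tate / Euler–Poincaré over `ℚ_n`; the census columns per row. The place above `p` is internal.
[cite: GreenbergLNM1716, §5 pp. 114–118, p. 137, Prop. 4.15 (ii)] [cite: Wuthrich2014, Thm. 16 (p. 397)]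
[cite: Washington1997, §13.1] -/
theorem X2.algebraicLambdaMem_layer_of_analyticMuLE_of_layerTorsion (hodd : p ≠ 2)
    (hWu : thm16_charIdeal_dvd_multiplicative_of_reducible)
    (hpar : nonempty_modularParametrizationData)
    (h415 : prop415ii_noFiniteSubmodule_of_ordinary_or_multiplicative)
    (hmult : W.HasMultiplicativeReductionAtPrime p) (hred : ¬ W.HasIrreducibleModPGaloisRep p)
    {m' : ℕ} (hμ : X2.AnalyticMuLE W p m') (n : ℕ)
    (hPT : ∀ (κ : ZpExtension ℚ p) [NumberField (κ.layer n)], κ.IsCyclotomic →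
      poitouTate_selmerStructure_duality (κ.layer n))
    (hEP : ∀ (κ : ZpExtension ℚ p) [NumberField (κ.layer n)], κ.IsCyclotomic →
      ∀ w : HeightOneSpectrum (𝓞 (κ.layer n)),
      localEulerPoincareCharacteristic (w.adicCompletion (κ.layer n)))
    {k : ℕ} (hB : ∀ κ : ZpExtension ℚ p, κ.IsCyclotomic →
      Nat.card {b : geomPrimaryTorsion W p //
        ∀ σ : Field.absoluteGaloisGroup ℚ, σ ∈ κ.layerSubgroup n → σ • b = b} ≤ p ^ k)
    (S : Finset (HeightOneSpectrum (𝓞 ℚ))) (m : HeightOneSpectrum (𝓞 ℚ) → ℕ)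
    (hSp : ∀ v ∈ S, ((p : ℕ) : 𝓞 ℚ) ∉ v.asIdeal)
    (hval : ∀ v ∈ S, padicValNat p (v.residueCard ^ (p - 1) - 1) = m v + 1)
    (hcv : ∀ v ∈ S,
      p ∣ (W.baseChange (v.adicCompletion ℚ)).localTamagawaNumber (v.adicCompletionIntegers ℚ)) :
    AlgebraicLambdaMem W p {d | ∑ v ∈ S, p ^ min n (m v) ≤ d + p ^ n * m' + 2 * k} := by
  intro κ γ hκ hγ hγ' D _ hXt
  -- the place above `p`
  set vp : HeightOneSpectrum (𝓞 ℚ) := (Rat.HeightOneSpectrum.primesEquiv (R := 𝓞 ℚ)).symm ⟨p, hp.out⟩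
    with hvpdef
  have hvp : ((p : ℕ) : 𝓞 ℚ) ∈ vp.asIdeal :=
    (natCast_mem_asIdeal_iff_eq_primesEquiv_symm vp hp.out).mpr hvpdef
  have hμD : D.mu ≤ m' :=
    (X2.isTorsion_and_mu_le_of_analyticMuLE hWu hpar hodd hmult hred hμ hκ hγ hγ' D).2
  have hnf : ∀ N : Submodule (IwasawaAlgebra p) D.X, Finite N → N = ⊥ :=
    noFiniteSubmoduleAt_of_prop415ii_mult h415 hodd hmult hκ hγ hγ' D hXt
  have h := sum_pow_min_le_lambda_add_of_certificates hodd n hPT hEP hmult vp hvp S m hSp hval hcv hκ D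
    hXt hnf (hB κ hκ)
  have hμD' : muInvariant p D.X ≤ m' := hμD
  show ∑ v ∈ S, p ^ min n (m v) ≤ lambdaInvariant p D.X + p ^ n * m' + 2 * k
  exact h.trans (Nat.add_le_add_right (Nat.add_le_add_left (Nat.mul_le_mul_left _ hμD') _) _)

/-- **The λ-conjunct of `stub_lambdaCount_offLocus` from the TOWER count at `p ‖ N`:
`AlgebraicLambdaGE W p (Σ_{v∈S} p^{min(n,m_v)} − pⁿ m' − 2k)`** for an X2 member with `μ_an ≤ m'`
(`X2.AnalyticMuLE W p m'`), a layer-`n` torsion certificate `#E[p^∞]^{Gal(ℚ̄/ℚ_n)} ≤ p^k` (every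
cyclotomic `κ`), and the three census columns `v ∤ p`, `v_p(N(v)^{p−1} − 1) = m_v + 1`, `p ∣ c_v` on `S`.
At the étale end `W₀` of a type-A split class (`m' = 0` by `stub_analyticMuZero_offLocus`, `k = 1`):
`λ(X(W₀/ℚ_∞)) ≥ Σ_{v∈S} min(s_v, pⁿ) − 2` for every `n`, i.e. `≥ Σ_v s_v − 2` — the tower budget lam-a's
route-T closure on the Mazur twin family asks of lam-b beyond «all `s_ℓ = 1`» (consumed with the parity
squeeze `λ_an ≤ λ_alg + e + 1`). Modulo the named facts `hPT`/`hEP` (over `ℚ_n`), `h415`, `hWu`, `hpar`.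
[cite: GreenbergLNM1716, §5 pp. 114–118, p. 137, Prop. 4.15 (ii)] [cite: Wuthrich2014, Thm. 16 (p. 397)]
[cite: GreenbergVatsal2000, §2 p. 28] -/
theorem X2.algebraicLambdaGE_layer_of_analyticMuLE_of_layerTorsion (hodd : p ≠ 2)
    (hWu : thm16_charIdeal_dvd_multiplicative_of_reducible)
    (hpar : nonempty_modularParametrizationData)
    (h415 : prop415ii_noFiniteSubmodule_of_ordinary_or_multiplicative)
    (hmult : W.HasMultiplicativeReductionAtPrime p) (hred : ¬ W.HasIrreducibleModPGaloisRep p)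
    {m' : ℕ} (hμ : X2.AnalyticMuLE W p m') (n : ℕ)
    (hPT : ∀ (κ : ZpExtension ℚ p) [NumberField (κ.layer n)], κ.IsCyclotomic →
      poitouTate_selmerStructure_duality (κ.layer n))
    (hEP : ∀ (κ : ZpExtension ℚ p) [NumberField (κ.layer n)], κ.IsCyclotomic →
      ∀ w : HeightOneSpectrum (𝓞 (κ.layer n)),
      localEulerPoincareCharacteristic (w.adicCompletion (κ.layer n)))
    {k : ℕ} (hB : ∀ κ : ZpExtension ℚ p, κ.IsCyclotomic →
      Nat.card {b : geomPrimaryTorsion W p //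
        ∀ σ : Field.absoluteGaloisGroup ℚ, σ ∈ κ.layerSubgroup n → σ • b = b} ≤ p ^ k)
    (S : Finset (HeightOneSpectrum (𝓞 ℚ))) (m : HeightOneSpectrum (𝓞 ℚ) → ℕ)
    (hSp : ∀ v ∈ S, ((p : ℕ) : 𝓞 ℚ) ∉ v.asIdeal)
    (hval : ∀ v ∈ S, padicValNat p (v.residueCard ^ (p - 1) - 1) = m v + 1)
    (hcv : ∀ v ∈ S,
      p ∣ (W.baseChange (v.adicCompletion ℚ)).localTamagawaNumber (v.adicCompletionIntegers ℚ)) :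
    AlgebraicLambdaGE W p (∑ v ∈ S, p ^ min n (m v) - p ^ n * m' - 2 * k) := by
  refine X2.algebraicLambdaGE_of_algebraicLambdaMem_Ici_of_analyticMuLE hWu hpar hodd hmult hred hμ ?_
  intro κ γ hκ hγ hγ' D _ hXt
  have h := X2.algebraicLambdaMem_layer_of_analyticMuLE_of_layerTorsion hodd hWu hpar h415 hmult hred hμ
    n hPT hEP hB S m hSp hval hcv κ γ hκ hγ hγ' D hXt
  simp only [Set.mem_setOf_eq] at h
  show _ ∈ Set.Ici _
  rw [Set.mem_Ici]
  omega

end Stub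

end Summit.BirchSwinnertonDyer.BirchSwinnertonDyer.Theorems.EisensteinPrimesX2TowerBudgetTorsion

end
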